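import Mathlib
import HarnessLib
import Literature.NumberTheory.LFunctions.RHWave0
import Literature.NumberTheory.LFunctions.LiouvilleOneSided
import Literature.NumberTheory.LFunctions.LiouvilleCharSumLinnikBox
import Literature.NumberTheory.LFunctions.LiouvilleCoprimeSum

/-!
# `TypeIILiouville` (crux stmt-Parity-13322, route `LiouvilleMAD`), line `Sketch`: Stub B

Characters modulo a prime `p`: the class `k ≡ −1 (mod p)` (i.e. `p ∣ k + 1`) of the summatory
Liouville function is detected by the orthogonality of the Dirichlet characters mod `p`,
`∑_χ χ(−1) χ(k) = (p − 1)·[p ∣ k + 1]` (Mathlib's `DirichletCharacter.sum_characters_eq`); the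
principal character contributes `∑_{k ≤ y, p ∤ k} λ(k) = L(y) − λ(p) L(⌊y/p⌋) = L(y) + L(⌊y/p⌋)`
(complete multiplicativity of `λ` and `λ(p) = −1`), whence

`∑_{k ≤ y, p ∣ k+1} λ(k) = (L(y) + L(⌊y/p⌋))/(p − 1) + (1/(p − 1)) ∑_{χ ≠ χ₀} χ(−1) ∑_{k ≤ y} λ(k)χ(k)`

(`stub_B`, consumed verbatim by Stub V of the line).
-/

noncomputable section

open Finset ArithmeticFunction Filter Asymptotics
open Literature.NumberTheory.LFunctions

namespace Summit.Parity.GeneralizedHardyLittlewood.Theorems.TypeIILiouville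

/-- Orthogonality of the Dirichlet characters modulo the prime `p` against `−1`:
`∑_χ χ(−1) χ(k) = (p − 1)·[p ∣ k + 1]`. -/
private theorem stubB_sum_char (p : ℕ) [Fact p.Prime] (k : ℕ) :
    ∑ χ : DirichletCharacter ℂ p, χ (-1) * χ (k : ZMod p) =
      if p ∣ k + 1 then ((p : ℂ) - 1) else 0 := by
  have hp : p.Prime := Fact.out
  haveI : NeZero p := ⟨hp.ne_zero⟩
  simp_rw [← map_mul]
  rw [DirichletCharacter.sum_characters_eq, Nat.totient_prime hp, Nat.cast_pred hp.pos]
  have h : (-1 * (k : ZMod p) = 1) ↔ p ∣ k + 1 := by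
    rw [neg_one_mul, neg_eq_iff_eq_neg, eq_neg_iff_add_eq_zero, ← Nat.cast_succ,
      ZMod.natCast_eq_zero_iff]
  by_cases hk : p ∣ k + 1
  · rw [if_pos hk, if_pos (h.2 hk)]
  · rw [if_neg hk, if_neg (fun h' => hk (h.1 h'))]

/-- The multiples of the prime `p` in `[1, y]` contribute `−L(⌊y/p⌋)`:
`∑_{k ≤ y, p ∣ k} λ(k) = ∑_{j ≤ y/p} λ(pj) = −∑_{j ≤ y/p} λ(j)` (`λ(pj) = λ(p)λ(j) = −λ(j)`). -/
private theorem stubB_sum_dvd_eq {p : ℕ} (hp : p.Prime) (y : ℕ) :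
    ∑ k ∈ (Icc 1 y).filter (fun k => p ∣ k), liouville k = -∑ j ∈ Icc 1 (y / p), liouville j := by
  rw [LiouvilleCoprimeSum.filter_dvd_Icc_eq_image hp.pos, sum_image, ← sum_neg_distrib]
  · refine sum_congr rfl fun j _ => ?_
    rw [liouville_apply_mul, liouville_apply hp.ne_zero, cardFactors_apply_prime hp, pow_one,
      neg_one_mul]
  · intro a _ b _ h
    exact Nat.eq_of_mul_eq_mul_left hp.pos h

/-- For `p` prime: `∑_{k ≤ y, (k,p)=1} λ(k) = ∑_{k ≤ y} λ(k) + ∑_{j ≤ y/p} λ(j)` (remove the multiples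
`pj` of `p`, `λ(pj) = −λ(j)`). -/
private theorem stubB_sum_coprime_eq {p : ℕ} (hp : p.Prime) (y : ℕ) :
    ∑ k ∈ (Icc 1 y).filter (fun k => k.Coprime p), liouville k =
      ∑ k ∈ Icc 1 y, liouville k + ∑ j ∈ Icc 1 (y / p), liouville j := by
  have hsplit := Finset.sum_filter_add_sum_filter_not (Icc 1 y) (fun k => p ∣ k)
    (fun k => liouville k)
  have hcop : (Icc 1 y).filter (fun k => k.Coprime p) = (Icc 1 y).filter (fun k => ¬ p ∣ k) := by
    refine filter_congr fun k _ => ?_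
    rw [Nat.coprime_comm, hp.coprime_iff_not_dvd]
  rw [hcop, ← hsplit, stubB_sum_dvd_eq hp y]
  ring

/-- The summatory Liouville function at a natural number, cast to `ℂ`:
`(L(n) : ℂ) = ∑_{k ∈ [1, n]} (λ(k) : ℂ)`. -/
private theorem stubB_liouvilleSum_natCast (n : ℕ) :
    ((liouvilleSum (n : ℝ) : ℤ) : ℂ) = ∑ k ∈ Icc 1 n, (liouville k : ℂ) := by
  rw [liouvilleSum_eq_sum_Icc, Nat.floor_natCast, Int.cast_sum]

/-- The principal character mod the prime `p`: `∑_{k ≤ y} λ(k) χ₀(k) = L(y) + L(⌊y/p⌋)` in `ℂ`. -/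
private theorem stubB_principal (p : ℕ) [Fact p.Prime] (y : ℕ) :
    ∑ k ∈ Icc 1 y, (liouville k : ℂ) * (1 : DirichletCharacter ℂ p) (k : ZMod p) =
      (liouvilleSum (y : ℝ) : ℂ) + (liouvilleSum ((y / p : ℕ) : ℝ) : ℂ) := by
  have hp : p.Prime := Fact.out
  rw [LiouvilleCharSumLinnikBox.sum_liouville_one_eq p y, stubB_liouvilleSum_natCast,
    stubB_liouvilleSum_natCast]
  have h := congrArg (fun z : ℤ => (z : ℂ)) (stubB_sum_coprime_eq hp y)
  simp only [Int.cast_add, Int.cast_sum] at h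
  rw [← h]
  push_cast
  rfl

/-- **Stub B.** For `p` prime and `y : ℕ`:
`∑_{k≤y, p∣k+1} λ(k) = (L(y) + L(⌊y/p⌋))/(p−1) + (1/(p−1)) ∑_{χ≠χ₀ mod p} χ(−1) ∑_{k≤y} λ(k)χ(k)`
(orthogonality of the characters mod `p` against the unit `−1`, the principal character evaluated by
`λ(pj) = −λ(j)`). -/
theorem stub_B (p : ℕ) [Fact p.Prime] (y : ℕ) :
    (∑ k ∈ (Icc 1 y).filter (fun k => p ∣ k + 1), (liouville k : ℂ)) =
      ((liouvilleSum (y : ℝ) : ℂ) + (liouvilleSum ((y / p : ℕ) : ℝ) : ℂ)) / ((p : ℂ) - 1) +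
        (1 / ((p : ℂ) - 1)) * ∑ χ ∈ (univ : Finset (DirichletCharacter ℂ p)).erase 1,
          χ (-1) * ∑ k ∈ Icc 1 y, (liouville k : ℂ) * χ (k : ZMod p) := by
  have hp : p.Prime := Fact.out
  haveI : NeZero p := ⟨hp.ne_zero⟩
  have hp1 : ((p : ℂ) - 1) ≠ 0 := sub_ne_zero.2 (by exact_mod_cast hp.one_lt.ne')
  -- (A) orthogonality: the full character sum is `(p − 1)` times the class sum
  have hA : ∑ χ : DirichletCharacter ℂ p, χ (-1) * ∑ k ∈ Icc 1 y, (liouville k : ℂ) * χ (k : ZMod p) =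
      ((p : ℂ) - 1) * ∑ k ∈ (Icc 1 y).filter (fun k => p ∣ k + 1), (liouville k : ℂ) := by
    calc ∑ χ : DirichletCharacter ℂ p, χ (-1) * ∑ k ∈ Icc 1 y, (liouville k : ℂ) * χ (k : ZMod p)
        = ∑ χ : DirichletCharacter ℂ p, ∑ k ∈ Icc 1 y,
            (liouville k : ℂ) * (χ (-1) * χ (k : ZMod p)) := by
          refine sum_congr rfl fun χ _ => ?_
          rw [mul_sum]
          refine sum_congr rfl fun k _ => ?_
          ring
      _ = ∑ k ∈ Icc 1 y, (liouville k : ℂ) *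
            ∑ χ : DirichletCharacter ℂ p, χ (-1) * χ (k : ZMod p) := by
          rw [sum_comm]
          refine sum_congr rfl fun k _ => ?_
          rw [mul_sum]
      _ = ∑ k ∈ Icc 1 y, if p ∣ k + 1 then ((p : ℂ) - 1) * (liouville k : ℂ) else 0 := by
          refine sum_congr rfl fun k _ => ?_
          rw [stubB_sum_char p k]
          split_ifs <;> ring
      _ = ((p : ℂ) - 1) * ∑ k ∈ (Icc 1 y).filter (fun k => p ∣ k + 1), (liouville k : ℂ) := by
          rw [sum_filter, mul_sum]
          refine sum_congr rfl fun k _ => ?_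
          rw [mul_ite, mul_zero]
  -- (B) split off the principal character
  have hone : (1 : DirichletCharacter ℂ p) (-1) = 1 := MulChar.one_apply isUnit_one.neg
  have hsplit := Finset.add_sum_erase (univ : Finset (DirichletCharacter ℂ p))
    (fun χ => χ (-1) * ∑ k ∈ Icc 1 y, (liouville k : ℂ) * χ (k : ZMod p)) (mem_univ 1)
  simp only [hone, one_mul, stubB_principal p y] at hsplit
  -- assemble
  have hL : ∑ k ∈ (Icc 1 y).filter (fun k => p ∣ k + 1), (liouville k : ℂ) =
      (1 / ((p : ℂ) - 1)) *
        ∑ χ : DirichletCharacter ℂ p, χ (-1) * ∑ k ∈ Icc 1 y, (liouville k : ℂ) * χ (k : ZMod p) := by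
    rw [hA]; field_simp
  rw [hL, ← hsplit]
  field_simp

end Summit.Parity.GeneralizedHardyLittlewood.Theorems.TypeIILiouville

end
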